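import Mathlib
import Summits.NavierStokesRegularity.NavierStokesRegularity.Theses.CalmSliceGate
import HarnessLib

/-!
# `CalmSliceGate.Assembly` — the route's assembly (item stmt-NavierStokesRegularity-24378; pure logic)

**Statement.** `EnstrophyQuarterLaw → RecordTimeTypeI → DissipativeZoom → OneCalmSlice →
PerpetualFlickerLiouville → NavierStokesRegularity`.

PROOF. The route file `Theses/CalmSliceGate.lean` carries the planner-authored, kernel-checked
deciding theorem `Theses.CalmSliceGate.closes`, whose hypotheses are exactly the route's five items
and whose conclusion is the sub-problem Statement; the assembly item is that implication written as
ONE proposition, so it is closed by applying `closes`. This proves an IMPLICATION only: the five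
hypotheses (two of them open cruxes) remain hypotheses.

HONEST FRAMING: pure logic between the route's own statements; the file does NOT prove
`NavierStokesRegularity`.
-/

noncomputable section

set_option linter.dupNamespace false

namespace Summit.NavierStokesRegularity.NavierStokesRegularity.Theorems

open Summit.NavierStokesRegularity.NavierStokesRegularity.Theses.CalmSliceGate in
/-- **Item stmt-NavierStokesRegularity-24378** (`CalmSliceGate.Assembly`): the route's five items
imply the sub-problem Statement, by the route file's deciding theorem `closes` (an implication; its
hypotheses stay hypotheses). [this file] -/
theorem calmSliceGate_assembly_proof :
    Summit.NavierStokesRegularity.NavierStokesRegularity.Theses.CalmSliceGate.Assembly := by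
  unfold Summit.NavierStokesRegularity.NavierStokesRegularity.Theses.CalmSliceGate.Assembly
  intro hQ hR hZ hCalm hFlick
  exact closes hQ hR hZ hCalm hFlick

end Summit.NavierStokesRegularity.NavierStokesRegularity.Theorems

end
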